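import Literature.AnabelianGeometry.AbsoluteAnabelian.AbsTopII.InertiaDecompositionProducts
import Literature.AnabelianGeometry.AbsoluteAnabelian.AbsTopII.InertiaDecompositionProofs
import Literature.AnabelianGeometry.AbsoluteAnabelian.FreeProcyclicModel
import Mathlib.NumberTheory.Padics.ProperSpace
import Mathlib.Topology.MetricSpace.Ultra.TotallySeparated

/-!
# [AbsTopII] Prop 1.3 (iii) as typed is SATISFIABLE with `I_v ≅ ℤ_l` realised — a procyclic model

S. Mochizuki, *Topics in Absolute Anabelian Geometry II* [AbsTopII] (bib `MochizukiAbsTopII2013`;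
locators = PDF pages of the kurims manuscript `paper:url-585b8d0ad0d9`), §1, Prop 1.3 (iii) p. 11
("`D_v ∩ Π_I = I_v × Π_v`; as abstract profinite groups, `I_v ≅ Ẑ^Σ`"), (v) p. 12.

abc-iut-L4-t6 typed Prop 1.3 over ABSTRACT DPSC data (`DPSCIndexData`; FACT-LIST rows F-0297
`Prop_1_3_i`, F-0298 `Prop_1_3_ii`, F-0299 `Prop_1_3_iii'`) and PROVED the typed (iii), (v), (v)-middle
from printed inputs (`prop_1_3_iii'_of_inputs`, `prop13v_of_prop_1_3_iii'`,
`prop_1_3_v'_of_prop_1_3_iii'`); `AbsTopII/InertiaGroupsSchemaCertificates.lean` shows the universal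
closures FAIL (at finite data: "`≅ Ẑ^Σ`" forces infinitude).  Second readers asked for the
complementary VACUITY check (RQ7 INFO on p425615 / p427149: "joint satisfiability of the binder
package not witnessed").  This proof-only file (no definitions) supplies it with the `Ẑ^Σ`-clause
REALISED by an infinite group, not evaded:

* `AbsTopII.DPSCIndexData.exists_procyclic_model` — for every prime `l` there are DPSC data with
  `Π_H = Π_I = ℤ_l` (Mathlib's `ℤ_[l]`, multiplicatively; `isFreeProSigmaCyclic_singleton_padicInt`),
  `Π_𝔾 = Π_v = {1}`, ONE vertex, no nodes, no cusps, `Σ = {l}`, at which: `I_v = ℤ_l` is free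
  pro-`{l}`-cyclic (so the "`I_v ≅ Ẑ^Σ`" conjunct holds NON-vacuously); EVERY explicit hypothesis of
  `prop_1_3_iii'_of_inputs` and of `prop13v_of_prop_1_3_iii'` / `prop_1_3_v'_of_prop_1_3_iii'` holds;
  hence (through those reductions) the typed `Prop_1_3_iii'`, `Prop13v`, `Prop_1_3_v'` hold, and the
  typed `Prop_1_3_i`, `Prop_1_3_ii` hold (vacuously: no edges).

So F-0299 (with F-0278, F-0300) is a CONTINGENT schema: refuted universally, satisfied here — a
genuine hypothesis on the data, consumable by name.  The model is a TOY (a "curve" with trivial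
geometric fundamental group is not a stable log curve); it certifies consistency of OUR typing and of
the reductions' binder packages, nothing about print.  A model realising (i) or the cusp clause of
(iii) non-vacuously would need a slim non-abelian `Π_v ⊇ Π_e ≅ Ẑ^Σ` with `Π_e` commensurably terminal
(free pro-`Σ` products), which Mathlib does not have.
HONEST FRAMING: typed ≠ proved; no side taken on [IUTchIII] Cor 3.12.
-/

open scoped Pointwise

namespace Literature.AnabelianGeometry.AbsoluteAnabelian.AbsTopII.DPSCIndexData

open Literature.AlgebraicGeometry.Frobenioids (IsSlimGroup)

/-- **A procyclic model of the typed [AbsTopII] Prop 1.3 (i)–(iii), (v).**  For a prime `l`, the DPSC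
data `Π_H = Π_I = ℤ_l`, `Π_𝔾 = Π_v = 1` (one vertex `v`, no edges), `Σ = {l}` satisfy: `I_v = ℤ_l` is
free pro-`{l}`-cyclic; all explicit hypotheses of abc-iut-L4-t6's reductions `prop_1_3_iii'_of_inputs`
([CombGC] Prop 1.2 (ii) for `Π_v`, `Π_e`; `Π_v` slim; `I_v·Π_𝔾 = Π_I`; `I_v ≅ Ẑ^Σ`; cusp conjugates)
and `prop13v_of_prop_1_3_iii'` (graphicity, [CombGC] Prop 1.2 (i), "(iv) at open subgroups");
consequently the typed `Prop_1_3_i`, `Prop_1_3_ii` (no edges), `Prop_1_3_iii'`, `Prop13v`,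
`Prop_1_3_v'`.  Non-vacuity certificate for FACT-LIST F-0297 / F-0298 / F-0299 (and F-0278, F-0300).
[cite: MochizukiAbsTopII2013, Prop 1.3 (iii) p.11] -/
theorem exists_procyclic_model (l : ℕ) [hl : Fact l.Prime] :
    ∃ X : DPSCIndexData.{0}, Nonempty X.Vert ∧ X.Sigma = {l} ∧
      (∀ v : X.Vert, IsFreeProSigmaCyclic {l} ↥(X.Iv v)) ∧
      -- the binder package of `prop_1_3_iii'_of_inputs`
      (∀ v : X.Vert, IsCommensurablyTerminal ((X.vertSub v).subgroupOf X.PiG)) ∧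
      (∀ e : X.Cusp, IsCommensurablyTerminal ((X.cuspSub e).subgroupOf X.PiG)) ∧
      (∀ v : X.Vert, IsSlimGroup ↥(X.vertSub v)) ∧
      (∀ v : X.Vert, X.Iv v ⊔ X.PiG = X.PiI) ∧
      (∀ v : X.Vert, IsFreeProSigmaCyclic X.Sigma ↥(X.Iv v)) ∧
      (∀ e : X.Cusp, ∃ g : X.PiH, MulAut.conj g • X.Iv (X.cuspVert e) ≤ X.DvCusp e ⊓ X.PiI ∧
        ∀ a ∈ X.IvCusp e, ∀ b ∈ MulAut.conj g • X.Iv (X.cuspVert e), a * b = b * a) ∧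
      -- the further binders of `prop13v_of_prop_1_3_iii'` / `prop_1_3_v'_of_prop_1_3_iii'`
      (∀ (g : X.PiH) (v : X.Vert), ∃ v' : X.Vert, ∃ γ ∈ X.PiG,
        MulAut.conj g • X.vertSub v = MulAut.conj γ • X.vertSub v') ∧
      (∀ (v v' : X.Vert) (γ : X.PiH), γ ∈ X.PiG →
        (MulAut.conj γ • X.vertSub v' ⊓ X.vertSub v).relIndex (X.vertSub v) ≠ 0 → v' = v) ∧
      (∀ (v : X.Vert) (g : X.PiH), X.Iv v ⊓ MulAut.conj g • X.Iv v ≠ ⊥ →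
        MulAut.conj g • X.vertSub v = X.vertSub v) ∧
      -- the typed predicates hold at the model
      Literature.AnabelianGeometry.AbsoluteAnabelian.AbsTopII.DPSCIndexData.Prop_1_3_i X ∧
      Literature.AnabelianGeometry.AbsoluteAnabelian.AbsTopII.DPSCIndexData.Prop_1_3_ii X ∧
      Literature.AnabelianGeometry.AbsoluteAnabelian.AbsTopII.DPSCIndexData.Prop_1_3_iii' X ∧
      Literature.AnabelianGeometry.AbsoluteAnabelian.DPSCData.Prop13v X.toDPSCData ∧
      Literature.AnabelianGeometry.AbsoluteAnabelian.AbsTopII.DPSCIndexData.Prop_1_3_v' X := by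
  let P : ProfiniteGrp.{0} := ProfiniteGrp.of (Multiplicative ℤ_[l])
  let X : DPSCIndexData.{0} :=
    { PiH := P
      PiG := ⊥
      normal_PiG := inferInstance
      isClosed_PiG := by rw [Subgroup.coe_bot]; exact isClosed_singleton
      PiI := ⊤
      PiG_le_PiI := bot_le
      normal_PiI := inferInstance
      Vert := PUnit
      Node := PEmpty
      Cusp := PEmpty
      vertSub := fun _ => ⊥
      vertSub_le := fun _ => le_rfl
      nodeSub := fun e => e.elim
      nodeSub_le := fun e => e.elim
      cuspSub := fun e => e.elim
      cuspSub_le := fun e => e.elim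
      nodeAbuts := fun e _ => e.elim
      cuspVert := fun e => e.elim
      Sigma := {l}
      sigma_prime := ⟨Set.singleton_nonempty l,
        fun p hp => by rw [Set.mem_singleton_iff.mp hp]; exact hl.out⟩
      sigmaIndex := fun e => e.elim
      sigmaIndex_isSigmaInteger := fun e => e.elim }
  -- `I_v = Z_{Π_I}(1) = Π_I = ℤ_l`
  have hIv : ∀ v : X.Vert, X.Iv v = ⊤ := by
    intro v
    change Subgroup.centralizer ((⊥ : Subgroup P) : Set P) ⊓ ⊤ = ⊤
    rw [inf_top_eq, Subgroup.centralizer_eq_top_iff_subset, Subgroup.coe_bot]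
    exact Set.singleton_subset_iff.2 (Subgroup.one_mem _)
  -- `ℤ_l ≃ₜ* ⊤ ≤ ℤ_l`
  let f : P ≃ₜ* ↥(⊤ : Subgroup P) :=
    { (Subgroup.topEquiv : (⊤ : Subgroup P) ≃* P).symm with
      continuous_toFun := by
        show Continuous fun g : P => (⟨g, Subgroup.mem_top g⟩ : ↥(⊤ : Subgroup P))
        exact continuous_id.subtype_mk _
      continuous_invFun := by
        show Continuous fun g : ↥(⊤ : Subgroup P) => (g : P)
        exact continuous_subtype_val }
  have h0 : IsFreeProSigmaCyclic {l} P := isFreeProSigmaCyclic_singleton_padicInt l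
  have hcycl : ∀ v : X.Vert, IsFreeProSigmaCyclic {l} ↥(X.Iv v) := by
    intro v
    rw [hIv v]
    exact h0.of_continuousMulEquiv f
  -- the trivial group `Π_𝔾 = Π_v = 1`: all its subgroups coincide
  haveI : Subsingleton ↥(⊥ : Subgroup P) :=
    ⟨fun a b => Subtype.ext ((Subgroup.mem_bot.mp a.2).trans (Subgroup.mem_bot.mp b.2).symm)⟩
  have hCTv : ∀ v : X.Vert, IsCommensurablyTerminal ((X.vertSub v).subgroupOf X.PiG) :=
    fun v => ⟨Subsingleton.elim _ _⟩
  have hslim : ∀ v : X.Vert, IsSlimGroup ↥(X.vertSub v) :=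
    fun v => ⟨fun H _ => Subsingleton.elim _ _⟩
  have hsurj : ∀ v : X.Vert, X.Iv v ⊔ X.PiG = X.PiI := by
    intro v
    rw [hIv v]
    exact top_sup_eq _
  have hcyc : ∀ v : X.Vert, IsFreeProSigmaCyclic X.Sigma ↥(X.Iv v) := hcycl
  have hCTc : ∀ e : X.Cusp, IsCommensurablyTerminal ((X.cuspSub e).subgroupOf X.PiG) :=
    fun e => e.elim
  have hcusp : ∀ e : X.Cusp, ∃ g : X.PiH, MulAut.conj g • X.Iv (X.cuspVert e) ≤ X.DvCusp e ⊓ X.PiI ∧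
      ∀ a ∈ X.IvCusp e, ∀ b ∈ MulAut.conj g • X.Iv (X.cuspVert e), a * b = b * a :=
    fun e => e.elim
  have hGRv : ∀ (g : X.PiH) (v : X.Vert), ∃ v' : X.Vert, ∃ γ ∈ X.PiG,
      MulAut.conj g • X.vertSub v = MulAut.conj γ • X.vertSub v' := by
    intro g v
    refine ⟨v, 1, Subgroup.one_mem _, ?_⟩
    change MulAut.conj g • (⊥ : Subgroup P) = MulAut.conj (1 : P) • (⊥ : Subgroup P)
    rw [Subgroup.smul_bot, Subgroup.smul_bot]
  have hDetv : ∀ (v v' : X.Vert) (γ : X.PiH), γ ∈ X.PiG →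
      (MulAut.conj γ • X.vertSub v' ⊓ X.vertSub v).relIndex (X.vertSub v) ≠ 0 → v' = v :=
    fun v v' _ _ _ => Subsingleton.elim (α := PUnit) v' v
  have hL : ∀ (v : X.Vert) (g : X.PiH), X.Iv v ⊓ MulAut.conj g • X.Iv v ≠ ⊥ →
      MulAut.conj g • X.vertSub v = X.vertSub v := by
    intro v g _
    change MulAut.conj g • (⊥ : Subgroup P) = ⊥
    exact Subgroup.smul_bot _
  have hiii : X.Prop_1_3_iii' := X.prop_1_3_iii'_of_inputs hCTv hCTc hslim hsurj hcyc hcusp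
  refine ⟨X, ⟨PUnit.unit⟩, rfl, hcycl, hCTv, hCTc, hslim, hsurj, hcyc, hcusp, hGRv, hDetv, hL,
    fun e => e.elim, fun e => e.elim, hiii,
    X.prop13v_of_prop_1_3_iii' hiii hGRv hDetv hCTv hL,
    X.prop_1_3_v'_of_prop_1_3_iii' hiii hGRv hDetv hCTv hL⟩

end Literature.AnabelianGeometry.AbsoluteAnabelian.AbsTopII.DPSCIndexData
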